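import Summits.QuantumFields.YangMills.Theorems.BalabanLadderIRTwistedSlabColourMomentum
import Summits.QuantumFields.YangMills.Theorems.BalabanLadderIRTwistedSlabRealSliceDeterminant
import Literature.MathematicalPhysics.QuantumLattice.TwistEaterColourMomentumBasis
import Literature.LinearAlgebra.PiSubmoduleAdaptedBasis
import Literature.LinearAlgebra.AdaptedBasisBlockDeterminant
import Literature.LinearAlgebra.RealFormDeterminant
import HarnessLib

/-!
# `det_ℝ Δ|_{su} = det_ℂ Δ|_{traceless} = ∏_{p ≠ 0} det Δ_{ζ(p)}`: the Gaussian determinant of the twist-eating ladder factorises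
# over 't Hooft's colour momenta into scalar twisted-torus Laplacians (K31c of the T1-box programme)

HELPER toward stub **T1** `TwistedSlabAnchor` of LINE `twisted-slab-continuity` (crux `IRcof`, stmt-QuantumFields-26930, census row 43;
LEAD prover ym-ir-line-tsc-p1 g5; `--supports` the crux, `--as helper`).  Theorems only.  Consumes K31b (the intertwiner
`covLaplacian_ladder_colourMode`) and lit-4's kit: L32 `tracelessPowMulPowBasis` ('t Hooft's traceless basis `A^aB^b`, `(a,b) ≠ 0`, with its
`Ad`-phases), L33 `piAdaptedBasis` (`δ_x ⊗ Γ_p`), L31 `AdaptedBasis.det_eq_prod_det` (block determinant), L30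
`RealForm.det_restrict_eq_ofReal_det_restrict` (`det_ℂ = det_ℝ` on a real form).

* §1 `tracelessFields_eq_pi`; ★ `det_covLaplacian_traceless_ladder_eq_prod` — for a unitary Weyl pair `AB = ω·BA` (`ω` primitive), central
  unit decorations `c₂, c₃`, and ANY choice of uniformising phases `ζ₀(p)^{n₀} = ω^b`, `ζ₁(p)^{n₁} = ω^{−a}` (`p = (a,b) ≠ 0`):
  `det_ℂ (Δ|_{traceless}) = ∏_{p ≠ 0} det (twistedTorusLaplacian n₀ n₁ n₂ n₃ ![ζ₀ p, ζ₁ p, 1, 1])` (the GAUGED adapted basis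
  `g_p(x)·δ_x ⊗ Γ_p`, `Basis.unitsSMul`, is block-diagonal for `Δ` by K31b).
* §2 ★ `det_covLaplacian_traceless_eq_ofReal_det_su` — for EVERY unitary background: `det_ℂ (Δ|_{traceless}) = det_ℝ (Δ|_{𝔰𝔲})` (the
  `𝔰𝔲(N)`-valued fields are a real form of the traceless ones: `Φ = ½(Φ − Φᴴ) + I·(−I∕2)(Φ + Φᴴ)`).

HONEST FRAMING: finite-dimensional linear algebra at one box; T1-box for `SU(N)` is assembled from this in K31d; T1 0∕1; nothing here bears on
`IRcof`, `IR`, or the Yang–Mills mass gap (Clay: NOT proved); R4 = `BalabanLadder.UV` only.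
References: M. García Pérez, A. González-Arroyo, M. Okawa, JHEP 10 (2017) 150 §2.3–§2.5; D. S. Bernstein, *Matrix Mathematics* (2009) Prop. 2.8.1,
7.1.6; V. I. Arnold, *Ordinary Differential Equations* (2006) §18.4.
-/

set_option autoImplicit false

noncomputable section

open scoped Matrix BigOperators ComplexConjugate
open Finset Complex
open Literature.MathematicalPhysics.QuantumFieldTheory Literature.MathematicalPhysics.QuantumLattice
open Literature.Analysis.OperatorTheory
open Literature.Analysis.Matrix.TwistedCycleLaplacian (twistedTorusLaplacian)
open Literature.LinearAlgebra

namespace Summit.QuantumFields.YangMills.Cruxes.IRcof.TwistedSlab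

variable {N : ℕ} {n₀ n₁ n₂ n₃ : ℕ}

/-! ## §1 The gauged colour-momentum basis of the traceless fields and the block determinant -/

section Blocks

/-- The traceless fields are the `ker tr`-valued fields (for lit-4's `piAdaptedBasis`). [folklore] -/
theorem tracelessFields_eq_pi :
    tracelessFields N n₀ n₁ n₂ n₃ =
      Submodule.pi Set.univ (fun _ : FinTorusSite n₀ n₁ n₂ n₃ => LinearMap.ker (Matrix.traceLinearMap (Fin N) ℂ ℂ)) := by
  ext Φ
  rw [mem_tracelessFields, PiSubmodule.mem_pi_univ_iff]
  simp only [LinearMap.mem_ker, Matrix.traceLinearMap_apply]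

/-- The underlying function of the restricted Laplacian is the unrestricted one. [folklore] -/
theorem coe_covLaplacian_traceless {U : FinTorusSite n₀ n₁ n₂ n₃ × Fin 4 → Matrix (Fin N) (Fin N) ℂ}
    (hU : ∀ e, U e ∈ Matrix.unitaryGroup (Fin N) ℂ) (Φ : tracelessFields N n₀ n₁ n₂ n₃) :
    ((DiscreteWeitzenboeck.covLaplacian (tracelessD hU) (tracelessDadj hU) Φ : tracelessFields N n₀ n₁ n₂ n₃) :
        FinTorusSite n₀ n₁ n₂ n₃ → Matrix (Fin N) (Fin N) ℂ) =
      DiscreteWeitzenboeck.covLaplacian (covDerivₗ U) (covDerivAdjₗ U) (Φ : FinTorusSite n₀ n₁ n₂ n₃ → Matrix (Fin N) (Fin N) ℂ) := by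
  rw [DiscreteWeitzenboeck.covLaplacian_apply, DiscreteWeitzenboeck.covLaplacian_apply, Submodule.coe_sum]
  rfl

variable [NeZero N] [NeZero n₀] [NeZero n₁] [NeZero n₂] [NeZero n₃]

/-- ★ **BLOCK DETERMINANT OVER 'T HOOFT'S COLOUR MOMENTA.**  At the decorated twist-eating ladder `![A, B, c₂·1, c₃·1]` (`AB = ω·BA`, `ω` a
primitive `N`-th root of unity, `A, B` unitary, `conj(c_i)c_i = 1`), for any uniformising phases `ζ₀(p)^{n₀} = ω^b`, `ζ₁(p)^{n₁} = (ω^a)⁻¹`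
(`p = (a, b) ≠ (0,0)`): `det_ℂ (Δ|_{traceless fields}) = ∏_{p ≠ 0} det (twistedTorusLaplacian n₀ n₁ n₂ n₃ ![ζ₀ p, ζ₁ p, 1, 1])`.
[cite: GarciaperezGonzalezarroyoOkawa2017, §2.3–§2.5] [cite: Bernstein2009, Prop. 2.8.1] -/
theorem det_covLaplacian_traceless_ladder_eq_prod {A B : Matrix (Fin N) (Fin N) ℂ} {ω c₂ c₃ : ℂ}
    (hAu : A ∈ Matrix.unitaryGroup (Fin N) ℂ) (hBu : B ∈ Matrix.unitaryGroup (Fin N) ℂ) (hω : IsPrimitiveRoot ω N)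
    (hAB : A * B = ω • (B * A)) (hc₂ : star c₂ * c₂ = 1) (hc₃ : star c₃ * c₃ = 1)
    (ζ₀ ζ₁ : {p : Fin N × Fin N // p ≠ (0, 0)} → ℂ) (h₀ : ∀ p, ζ₀ p ^ n₀ = ω ^ (p.1.2 : ℕ))
    (h₁ : ∀ p, ζ₁ p ^ n₁ = (ω ^ (p.1.1 : ℕ))⁻¹)
    (hU : ∀ e, ladderField (n₀ := n₀) (n₁ := n₁) (n₂ := n₂) (n₃ := n₃)
      ![A, B, c₂ • (1 : Matrix (Fin N) (Fin N) ℂ), c₃ • (1 : Matrix (Fin N) (Fin N) ℂ)] e ∈ Matrix.unitaryGroup (Fin N) ℂ) :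
    LinearMap.det (DiscreteWeitzenboeck.covLaplacian (tracelessD hU) (tracelessDadj hU)) =
      ∏ p : {p : Fin N × Fin N // p ≠ (0, 0)}, (twistedTorusLaplacian n₀ n₁ n₂ n₃ ![ζ₀ p, ζ₁ p, 1, 1]).det := by
  classical
  have hA : IsUnit A := ⟨⟨A, Aᴴ, hAu.2, hAu.1⟩, rfl⟩
  have hB : IsUnit B := ⟨⟨B, Bᴴ, hBu.2, hBu.1⟩, rfl⟩
  have hω0 : ω ≠ 0 := hω.ne_zero (NeZero.ne N)
  -- 't Hooft's traceless basis and its phases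
  set b₃₂ := TwistEaterBasis.tracelessPowMulPowBasis hA hB hω hAB with hb₃₂
  set Γ : {p : Fin N × Fin N // p ≠ (0, 0)} → Matrix (Fin N) (Fin N) ℂ := fun p => (b₃₂ p : Matrix (Fin N) (Fin N) ℂ) with hΓ
  have hAΓ : ∀ p, A * Γ p * Aᴴ = ω ^ (p.1.2 : ℕ) • Γ p := fun p =>
    TwistEaterBasis.conj_tracelessPowMulPowBasis_fst hA hB hω hAB hAu.2 p
  have hBΓ : ∀ p, B * Γ p * Bᴴ = (ω ^ (p.1.1 : ℕ))⁻¹ • Γ p := fun p =>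
    TwistEaterBasis.conj_tracelessPowMulPowBasis_snd hA hB hω hAB hBu.2 p
  -- the gauge factors
  obtain ⟨g, hg⟩ : ∃ g : {p : Fin N × Fin N // p ≠ (0, 0)} → FinTorusSite n₀ n₁ n₂ n₃ → ℂ,
      ∀ p y, g p y = ζ₀ p ^ ((y.1 - 1 : Fin n₀) : ℕ) * ζ₁ p ^ ((y.2.1 - 1 : Fin n₁) : ℕ) := ⟨_, fun _ _ => rfl⟩
  have hζ₀ : ∀ p, ζ₀ p ≠ 0 := fun p h => by
    have := h₀ p; rw [h, zero_pow (NeZero.ne n₀)] at this; exact pow_ne_zero _ hω0 this.symm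
  have hζ₁ : ∀ p, ζ₁ p ≠ 0 := fun p h => by
    have := h₁ p; rw [h, zero_pow (NeZero.ne n₁)] at this; exact (inv_ne_zero (pow_ne_zero _ hω0)) this.symm
  have hg0 : ∀ p y, g p y ≠ 0 := fun p y => by rw [hg]; exact mul_ne_zero (pow_ne_zero _ (hζ₀ p)) (pow_ne_zero _ (hζ₁ p))
  -- the gauged adapted basis of the traceless fields
  set e := LinearEquiv.ofEq _ _ (tracelessFields_eq_pi (N := N) (n₀ := n₀) (n₁ := n₁) (n₂ := n₂) (n₃ := n₃)).symm with he
  set b₀ := (PiSubmodule.piAdaptedBasis (LinearMap.ker (Matrix.traceLinearMap (Fin N) ℂ ℂ)) (FinTorusSite n₀ n₁ n₂ n₃) b₃₂).map e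
    with hb₀
  set bT := b₀.unitsSMul (fun i => Units.mk0 (g i.1 i.2) (hg0 i.1 i.2)) with hbT
  have hcoe : ∀ p x, ((bT (p, x) : tracelessFields N n₀ n₁ n₂ n₃) : FinTorusSite n₀ n₁ n₂ n₃ → Matrix (Fin N) (Fin N) ℂ) =
      fun y => ((Pi.single x (1 : ℂ) : FinTorusSite n₀ n₁ n₂ n₃ → ℂ) y * g p y) • Γ p := by
    intro p x
    rw [hbT, Module.Basis.unitsSMul_apply, Units.smul_def, Units.val_mk0, Submodule.coe_smul, hb₀, Module.Basis.map_apply, he,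
      LinearEquiv.coe_ofEq_apply, PiSubmodule.coe_piAdaptedBasis]
    funext y
    dsimp only
    simp only [Pi.smul_apply, Pi.single_apply]
    split_ifs with hy
    · subst hy; rw [one_mul]
    · rw [zero_mul, zero_smul, smul_zero]
  -- the block structure
  refine AdaptedBasis.det_eq_prod_det bT _ (fun p => twistedTorusLaplacian n₀ n₁ n₂ n₃ ![ζ₀ p, ζ₁ p, 1, 1]) fun p x => ?_
  apply Subtype.ext
  rw [coe_covLaplacian_traceless hU, hcoe, Submodule.coe_sum]
  have hmode := covLaplacian_ladder_colourMode (n₀ := n₀) (n₁ := n₁) (n₂ := n₂) (n₃ := n₃) (Γ := Γ p)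
    (pow_ne_zero _ hω0) (inv_ne_zero (pow_ne_zero _ hω0)) (hAΓ p) (hBΓ p) hc₂ hc₃ (h₀ p) (h₁ p) hU (Pi.single x 1)
  simp only [← hg] at hmode
  rw [hmode]
  funext y
  simp only [Finset.sum_apply, Submodule.coe_smul, hcoe, Pi.smul_apply, smul_smul, Matrix.mulVec_single_one, Matrix.col_apply]
  rw [← Finset.sum_smul]
  congr 1
  rw [Finset.sum_eq_single y]
  · rw [Pi.single_eq_same, one_mul]
  · intro z _ hz
    rw [Pi.single_apply, if_neg (Ne.symm hz)]
    ring
  · intro h; exact absurd (Finset.mem_univ y) h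

end Blocks

/-! ## §2 The `𝔰𝔲`-valued fields are a real form of the traceless fields: `det_ℂ = det_ℝ` -/

section RealForm

/-- ★ **`det_ℂ (Δ|_{traceless}) = det_ℝ (Δ|_{𝔰𝔲})`** for every unitary background: the complex covariant Laplacian on the traceless fields and
THE NUMBER's real covariant Laplacian on `suFields` (K26 ∕ K29b ∕ K30b) have the same determinant (Arnold: `det ᶜA = det A`; the real form is
`Φ ↦ ½(Φ − Φᴴ)`, `Φ ↦ −(I∕2)(Φ + Φᴴ)`). [cite: Arnold2006ODE, §18.4 Problem 2] -/
theorem det_covLaplacian_traceless_eq_ofReal_det_su {U : FinTorusSite n₀ n₁ n₂ n₃ × Fin 4 → Matrix (Fin N) (Fin N) ℂ}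
    (hU : ∀ e, U e ∈ Matrix.unitaryGroup (Fin N) ℂ) :
    LinearMap.det (DiscreteWeitzenboeck.covLaplacian (tracelessD hU) (tracelessDadj hU)) =
      ((LinearMap.det (DiscreteWeitzenboeck.covLaplacian (suD hU) (suDadj hU)) : ℝ) : ℂ) := by
  set T := DiscreteWeitzenboeck.covLaplacian (covDerivₗ U) (covDerivAdjₗ U) with hT
  have hUtr : ∀ u ∈ tracelessFields N n₀ n₁ n₂ n₃, T u ∈ tracelessFields N n₀ n₁ n₂ n₃ := fun u hu => by
    rw [hT, DiscreteWeitzenboeck.covLaplacian_apply]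
    exact Submodule.sum_mem _ fun μ _ => covDerivAdjₗ_mem hU μ (covDerivₗ_mem hU μ hu)
  have hVsu : ∀ v ∈ suFields N n₀ n₁ n₂ n₃, (T.restrictScalars ℝ) v ∈ suFields N n₀ n₁ n₂ n₃ := fun v hv => by
    rw [LinearMap.restrictScalars_apply, hT, DiscreteWeitzenboeck.covLaplacian_apply]
    exact Submodule.sum_mem _ fun μ _ => covDerivAdj_mem_suFields hU μ (covDeriv_mem_suFields hU μ hv)
  have h1 : T.restrict hUtr = DiscreteWeitzenboeck.covLaplacian (tracelessD hU) (tracelessDadj hU) := by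
    apply LinearMap.ext; intro Φ; apply Subtype.ext
    rw [LinearMap.coe_restrict_apply, coe_covLaplacian_traceless hU]
  have h2 : (T.restrictScalars ℝ).restrict hVsu = DiscreteWeitzenboeck.covLaplacian (suD hU) (suDadj hU) := by
    apply LinearMap.ext; intro Φ; apply Subtype.ext
    rw [LinearMap.coe_restrict_apply, LinearMap.restrictScalars_apply, hT, DiscreteWeitzenboeck.covLaplacian_apply,
      DiscreteWeitzenboeck.covLaplacian_apply, Submodule.coe_sum]
    rfl
  have hVU : ∀ v ∈ suFields N n₀ n₁ n₂ n₃, v ∈ tracelessFields N n₀ n₁ n₂ n₃ := fun v hv x => ((mem_suFields.1 hv) x).2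
  have hspan : ∀ u ∈ tracelessFields N n₀ n₁ n₂ n₃, ∃ v ∈ suFields N n₀ n₁ n₂ n₃, ∃ w ∈ suFields N n₀ n₁ n₂ n₃, u = v + I • w := by
    intro u hu
    refine ⟨fun x => (2⁻¹ : ℂ) • (u x - (u x)ᴴ), fun x => ⟨?_, ?_⟩, fun x => (-(I / 2)) • (u x + (u x)ᴴ), fun x => ⟨?_, ?_⟩, ?_⟩
    · rw [Matrix.conjTranspose_smul, Matrix.conjTranspose_sub, Matrix.conjTranspose_conjTranspose, ← smul_neg, neg_sub]
      congr 1
      rw [Complex.star_def, map_inv₀, map_ofNat]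
    · rw [Matrix.trace_smul, Matrix.trace_sub, Matrix.trace_conjTranspose, (mem_tracelessFields.1 hu) x, star_zero, sub_zero, smul_zero]
    · rw [Matrix.conjTranspose_smul, Matrix.conjTranspose_add, Matrix.conjTranspose_conjTranspose, ← neg_smul, add_comm]
      congr 1
      rw [Complex.star_def, map_neg, map_div₀, Complex.conj_I, map_ofNat, neg_div, neg_neg]
    · rw [Matrix.trace_smul, Matrix.trace_add, Matrix.trace_conjTranspose, (mem_tracelessFields.1 hu) x, star_zero, add_zero, smul_zero]
    · funext x
      simp only [Pi.add_apply, Pi.smul_apply, smul_smul, smul_add, smul_sub]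
      have hI : I * -(I / 2) = 2⁻¹ := by rw [mul_neg, mul_div_assoc', Complex.I_mul_I]; norm_num
      rw [hI]
      module
  have hindep : ∀ v ∈ suFields N n₀ n₁ n₂ n₃, ∀ w ∈ suFields N n₀ n₁ n₂ n₃, v + I • w = 0 → v = 0 ∧ w = 0 := by
    intro v hv w hw h
    have hv' : star v = -v := funext fun x => by
      rw [Pi.star_apply, Pi.neg_apply, Matrix.star_eq_conjTranspose]; exact ((mem_suFields.1 hv) x).1
    have hw' : star w = -w := funext fun x => by
      rw [Pi.star_apply, Pi.neg_apply, Matrix.star_eq_conjTranspose]; exact ((mem_suFields.1 hw) x).1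
    exact RealForm.eq_zero_of_skewAdjoint_add_I_smul_eq_zero hv' hw' h
  rw [← h1, ← h2]
  exact RealForm.det_restrict_eq_ofReal_det_restrict T hUtr hVsu hVU hspan hindep

end RealForm

end Summit.QuantumFields.YangMills.Cruxes.IRcof.TwistedSlab

end
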